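/-
Copyright (c) 2026 the pub-hodgecm-mathlib formalisation cell (harness21).  Prover seat hodgecm-mathlib-K2E4-p14 (g9), Track B ∕ K2-LIT, h413 = `stmt-HodgeConjecture-24833`,
line `K2_E1_TraceFormulaBeta`, campaign 5Res ∕ 12R3 (ROADCARD §3′ M2 v2), after (245): the PRODUCT-GROUP instance of the top of the D-road — `K := K_∞ × K_f` with `K_∞` compact
ABELIAN and `K_f` profinite, `ιa := inl`, `ιf := inr` — discharging the structural binders (`ιa` central, orbit maps continuous) of ★ `residualSpectrumCompact_of_atoms` (this seat,
p860390), so that only the projector letters (P) and the atoms remain for the payers.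
-/
import Summits.HodgeConjecture.HodgeConjecture.Theorems.K2E1ResidualLevelFiniteOfAtomsU   -- ★ p860390 (this seat): `levelFinite_of_atoms`, `residual_admissible_of_atoms`, `residualSpectrumCompact_of_atoms`
import Literature.NumberTheory.Automorphic.AutomorphicSpectrumProofs                      -- ★ `isStronglyContinuous_rightRegular_holds`
import HarnessLib

/-!
# K2·E1 — `K2E1ResidualAtomsProductGroupU`: the top of the D-road at `K = K_∞ × K_f` (`K_∞` compact abelian, `K_f` profinite) — ATOMS ⟹ `R(f)|_{L²_res}` compact, with the
# structural binders discharged (generic `𝒢`, then the sockets 5Res ∕ 12R3 BY NAME)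

Track B ∕ K2-LIT, crux h413 = `stmt-HodgeConjecture-24833`, route of record `HCCMUnconditional`; cell `hodgecm-mathlib`, squad K2, ENGINE E1 (campaign 5Res ∕ 12R3, ROADCARD §3′ M2 v2).
THEOREMS ONLY (no `def`, no `instance`, no notation, no named-fact hypothesis, no `sorry`); lane `--supports stmt-HodgeConjecture-24833 --as helper` (count-neutral).  Closes no socket.

WHAT.  ★ `residualSpectrumCompact_of_atoms` (p860390) is stated for an abstract compact `K →* G(𝔸)` with an abelian-CENTRAL factor `ιa : T →* K` and a profinite factor `ιf : K_f →* K`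
whose orbit maps on `L²_res` are continuous.  In print `K = K_∞ × K_f` with `K_∞ = ∏_{v∣∞} (U(1) × U(1))` ABELIAN (`U(1,1)`; for `U(2,1)` one takes the centre or the compact torus of
`U(2) × U(1)`) and `K_f` compact open: then `ιa := inl` IS central (`K_∞` commutative) and the orbit maps of `ιf := inr` are continuous because the regular representation is
strongly continuous (★ `isStronglyContinuous_rightRegular_holds`) and `ιK ∘ inr` is continuous.  So at a product group the only binders left are the projector letters and the
atoms, indexed by characters `χ : K_∞ →* ℂ` and open subgroups `U ≤ K_f`, with `R(ιK(t, 1))`, `R(ιK(1, u))` in place of `R(ιK ιa t)`, `R(ιK ιf u)`.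
* §1 `continuous_orbit_inr` (the `hcont` binder), **`residualSpectrumCompact_of_atoms_prod`** (generic `𝒢`): compact abelian `K_∞`, profinite `K_f`, continuous `ιK : K_∞ × K_f →* G(𝔸)`,
  atoms ⟹ `ResidualSpectrumCompact 𝒢 μ 𝔓`.
* §2 the sockets BY NAME from the `∀ L μ ∃ (K_∞, K_f, ιK)`-package of atoms: **`sig_K2E1ResidualCompactU2_of_atoms_prod`**, **`sig_K2E1ResidualCompactU3R_of_atoms_prod`**.
HONEST LABEL: HC_CM is proved only modulo the 7 printed citations (2 remaining named inputs: hLiu418 = `stmt-HodgeConjecture-24832`, h413 = `stmt-HodgeConjecture-24833`) until rung 0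
closes; this file asserts no named fact and closes no socket — 5Res ∕ 12R3 stay OPEN until the atoms package is ★ (payers per the 14th-issue §F letter list).

## References
* [MoeglinWaldspurger1995] C. Mœglin, J.-L. Waldspurger, *Spectral decomposition and Eisenstein series* (1995), I.2.18, V.3.13.
* [BorelJacquet1979] A. Borel, H. Jacquet, *Automorphic forms and automorphic representations*, Corvallis I (1979), §4.6.
* [HarishChandra1968] Harish-Chandra, *Automorphic forms on semisimple Lie groups*, LNM 62 (1968), Thm. 1.
-/

set_option autoImplicit false
-- the mandated namespace repeats the single-problem summit's segment (`HodgeConjecture.HodgeConjecture`)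
set_option linter.dupNamespace false

noncomputable section

open MeasureTheory Measure Topology NumberField IsDedekindDomain
open Literature.NumberTheory.Automorphic Literature.NumberTheory.Automorphic.UnitaryGroup AdelicGroupData ContRepresentation
open Summit.HodgeConjecture.HodgeConjecture.Cruxes.H413.K2E1CuspidalSpectrumUnitary
open Summit.HodgeConjecture.HodgeConjecture.Cruxes.H413.K2E1ResidualLevelFiniteOfAtomsU (residualSpectrumCompact_of_atoms)

namespace Summit.HodgeConjecture.HodgeConjecture.Cruxes.H413.K2E1ResidualAtomsProductGroupU

universe u

section Generic

variable {F : Type} [Field F] [NumberField F] (𝒢 : AdelicGroupData.{u} F) (μ : Measure 𝒢.automorphicQuotient) [𝒢.IsAutomorphicMeasure μ]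
  (𝔓 : 𝒢.ParabolicUnipotentData)

/-- **THE ORBIT MAPS OF `K_f` ON `L²_res` ARE CONTINUOUS** (the `hcont` binder of ★ `residual_admissible_of_atoms` at `ιf := inr`): the regular representation is strongly continuous
(★ `isStronglyContinuous_rightRegular_holds`) and `k ↦ ιK (1, k)` is continuous. [cite: BorelJacquet1979, §4.6] -/
theorem continuous_orbit_inr {Kinf : Type*} [CommGroup Kinf] [TopologicalSpace Kinf] {Kf : Type*} [Group Kf] [TopologicalSpace Kf]
    (ιK : Kinf × Kf →* 𝒢.Adelic) (hι : Continuous ιK) (v : (residualSubspace 𝒢 μ 𝔓).toSubmodule) :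
    Continuous fun k : Kf => ((residualSubspace 𝒢 μ 𝔓).toContRep.restrict ιK) (MonoidHom.inr Kinf Kf k) v := by
  have h1 : Continuous fun k : Kf => 𝒢.rightRegular μ (ιK (MonoidHom.inr Kinf Kf k)) (v : 𝒢.L2 μ) :=
    (𝒢.isStronglyContinuous_rightRegular_holds μ (v : 𝒢.L2 μ)).comp (hι.comp (continuous_const.prodMk continuous_id))
  exact Continuous.subtype_mk h1 _

/-- **ATOMS ⟹ `ResidualSpectrumCompact 𝒢 μ 𝔓` AT A PRODUCT GROUP `K = K_∞ × K_f`** (`K_∞` compact Hausdorff ABELIAN, `K_f` compact Hausdorff totally disconnected, `ιK` continuous,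
`G(𝔸)` locally compact): ★ `residualSpectrumCompact_of_atoms` with `ιa := inl` (central since `K_∞` is commutative) and `ιf := inr` (§1); the atoms are indexed by `χ : K_∞ →* ℂ` and
open `U ≤ K_f`. [cite: MoeglinWaldspurger1995, I.2.18 and V.3.13] [cite: HarishChandra1968, Thm. 1] -/
theorem residualSpectrumCompact_of_atoms_prod [LocallyCompactSpace 𝒢.Adelic]
    {Kinf : Type*} [CommGroup Kinf] [TopologicalSpace Kinf] [IsTopologicalGroup Kinf] [CompactSpace Kinf] [T2Space Kinf]
    {Kf : Type*} [Group Kf] [TopologicalSpace Kf] [IsTopologicalGroup Kf] [CompactSpace Kf] [T2Space Kf] [TotallyDisconnectedSpace Kf]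
    (ιK : Kinf × Kf →* 𝒢.Adelic) (hι : Continuous ιK)
    (hatoms : ∀ (χ : Kinf →* ℂ) (U : OpenSubgroup Kf), ∃ (P : 𝒢.L2 μ →L[ℂ] 𝒢.L2 μ) (A : Submodule ℂ (𝒢.L2 μ)), FiniteDimensional ℂ A ∧
      (∀ x : 𝒢.L2 μ, (∀ u ∈ U, 𝒢.rightRegular μ (ιK (MonoidHom.inr Kinf Kf u)) x = x) → (∀ t : Kinf, 𝒢.rightRegular μ (ιK (MonoidHom.inl Kinf Kf t)) x = χ t • x) → P x = x) ∧
      ∀ W : ClosedSubrep (𝒢.rightRegular μ), W.toContRep.IsTopIrreducible → W ≤ residualSubspace 𝒢 μ 𝔓 → ∀ w ∈ W, P w ∈ A) :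
    ResidualSpectrumCompact 𝒢 μ 𝔓 :=
  residualSpectrumCompact_of_atoms 𝒢 μ 𝔓 ιK hι (MonoidHom.inl Kinf Kf) (fun t k => Prod.ext (mul_comm t k.1) (by simp)) (MonoidHom.inr Kinf Kf)
    (continuous_orbit_inr 𝒢 μ 𝔓 ιK hι) hatoms

end Generic

/-! ## §2 The sockets 5Res ∕ 12R3 BY NAME from the product-group atoms package -/

section Sockets

/-- **SOCKET 5Res BY NAME ⟸ the `∀ L μ ∃ (K_∞, K_f, ιK)`-package of ATOMS** for `L²_res(U(Φ₂)_{L∕L⁺})` (`K_∞` compact abelian, `K_f` profinite, `ιK : K_∞ × K_f →* U(Φ₂)(𝔸)` continuous).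
[cite: MoeglinWaldspurger1995, I.2.18 and V.3.13] [cite: HarishChandra1968, Thm. 1] -/
theorem sig_K2E1ResidualCompactU2_of_atoms_prod
    (h : ∀ (L : Type) [Field L] [NumberField L] [IsCMField L]
      (μ : Measure (UnitaryGroup.cmDatum L 2 (Matrix.of fun i j : Fin 2 => if i.val + j.val + 1 = 2 then (1 : L) else 0)).automorphicQuotient)
      [(UnitaryGroup.cmDatum L 2 (Matrix.of fun i j : Fin 2 => if i.val + j.val + 1 = 2 then (1 : L) else 0)).IsAutomorphicMeasure μ],
      ∃ (Kinf : Type) (_ : CommGroup Kinf) (_ : TopologicalSpace Kinf) (_ : IsTopologicalGroup Kinf) (_ : CompactSpace Kinf) (_ : T2Space Kinf)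
        (Kf : Type) (_ : Group Kf) (_ : TopologicalSpace Kf) (_ : IsTopologicalGroup Kf) (_ : CompactSpace Kf) (_ : T2Space Kf) (_ : TotallyDisconnectedSpace Kf)
        (ιK : Kinf × Kf →* (UnitaryGroup.cmDatum L 2 (Matrix.of fun i j : Fin 2 => if i.val + j.val + 1 = 2 then (1 : L) else 0)).Adelic) (_ : Continuous ιK),
        ∀ (χ : Kinf →* ℂ) (U : OpenSubgroup Kf),
          ∃ (P : (UnitaryGroup.cmDatum L 2 (Matrix.of fun i j : Fin 2 => if i.val + j.val + 1 = 2 then (1 : L) else 0)).L2 μ →L[ℂ]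
              (UnitaryGroup.cmDatum L 2 (Matrix.of fun i j : Fin 2 => if i.val + j.val + 1 = 2 then (1 : L) else 0)).L2 μ)
            (At : Submodule ℂ ((UnitaryGroup.cmDatum L 2 (Matrix.of fun i j : Fin 2 => if i.val + j.val + 1 = 2 then (1 : L) else 0)).L2 μ)), FiniteDimensional ℂ At ∧
          (∀ x : (UnitaryGroup.cmDatum L 2 (Matrix.of fun i j : Fin 2 => if i.val + j.val + 1 = 2 then (1 : L) else 0)).L2 μ,
            (∀ u ∈ U, (UnitaryGroup.cmDatum L 2 (Matrix.of fun i j : Fin 2 => if i.val + j.val + 1 = 2 then (1 : L) else 0)).rightRegular μ (ιK (MonoidHom.inr Kinf Kf u)) x = x) →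
            (∀ t : Kinf, (UnitaryGroup.cmDatum L 2 (Matrix.of fun i j : Fin 2 => if i.val + j.val + 1 = 2 then (1 : L) else 0)).rightRegular μ (ιK (MonoidHom.inl Kinf Kf t)) x = χ t • x) →
            P x = x) ∧
          ∀ W : ClosedSubrep ((UnitaryGroup.cmDatum L 2 (Matrix.of fun i j : Fin 2 => if i.val + j.val + 1 = 2 then (1 : L) else 0)).rightRegular μ),
            W.toContRep.IsTopIrreducible → W ≤ cmResidualSubspace L 2 μ → ∀ w ∈ W, P w ∈ At) :
    ∀ (L : Type) [Field L] [NumberField L] [IsCMField L]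
      (μ : Measure (UnitaryGroup.cmDatum L 2 (Matrix.of fun i j : Fin 2 => if i.val + j.val + 1 = 2 then (1 : L) else 0)).automorphicQuotient)
      [(UnitaryGroup.cmDatum L 2 (Matrix.of fun i j : Fin 2 => if i.val + j.val + 1 = 2 then (1 : L) else 0)).IsAutomorphicMeasure μ],
      K2E1CuspidalSpectrumUnitary.CmResidualSpectrumCompact L 2 μ := by
  intro L _ _ _ μ _
  obtain ⟨Kinf, _, _, _, _, _, Kf, _, _, _, _, _, _, ιK, hι, hatoms⟩ := h L μ
  exact residualSpectrumCompact_of_atoms_prod _ μ (cmParabolicData L 2) ιK hι hatoms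

/-- **SOCKET 12R3 BY NAME ⟸ the `∀ L μ ∃ (K_∞, K_f, ιK)`-package of ATOMS** for `L²_res(U(Φ₃)_{L∕L⁺})` along the Heisenberg radical of record (`K_∞` compact ABELIAN — at `N = 3` the
compact torus or the centre of `U(2) × U(1)`). [cite: MoeglinWaldspurger1995, I.2.18 and V.3.13] [cite: HarishChandra1968, Thm. 1] -/
theorem sig_K2E1ResidualCompactU3R_of_atoms_prod
    (h : ∀ (L : Type) [Field L] [NumberField L] [IsCMField L]
      (μ : Measure (UnitaryGroup.cmDatum L 3 (Matrix.of fun i j : Fin 3 => if i.val + j.val + 1 = 3 then (1 : L) else 0)).automorphicQuotient)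
      [(UnitaryGroup.cmDatum L 3 (Matrix.of fun i j : Fin 3 => if i.val + j.val + 1 = 3 then (1 : L) else 0)).IsAutomorphicMeasure μ],
      ∃ (Kinf : Type) (_ : CommGroup Kinf) (_ : TopologicalSpace Kinf) (_ : IsTopologicalGroup Kinf) (_ : CompactSpace Kinf) (_ : T2Space Kinf)
        (Kf : Type) (_ : Group Kf) (_ : TopologicalSpace Kf) (_ : IsTopologicalGroup Kf) (_ : CompactSpace Kf) (_ : T2Space Kf) (_ : TotallyDisconnectedSpace Kf)
        (ιK : Kinf × Kf →* (UnitaryGroup.cmDatum L 3 (Matrix.of fun i j : Fin 3 => if i.val + j.val + 1 = 3 then (1 : L) else 0)).Adelic) (_ : Continuous ιK),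
        ∀ (χ : Kinf →* ℂ) (U : OpenSubgroup Kf),
          ∃ (P : (UnitaryGroup.cmDatum L 3 (Matrix.of fun i j : Fin 3 => if i.val + j.val + 1 = 3 then (1 : L) else 0)).L2 μ →L[ℂ]
              (UnitaryGroup.cmDatum L 3 (Matrix.of fun i j : Fin 3 => if i.val + j.val + 1 = 3 then (1 : L) else 0)).L2 μ)
            (At : Submodule ℂ ((UnitaryGroup.cmDatum L 3 (Matrix.of fun i j : Fin 3 => if i.val + j.val + 1 = 3 then (1 : L) else 0)).L2 μ)), FiniteDimensional ℂ At ∧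
          (∀ x : (UnitaryGroup.cmDatum L 3 (Matrix.of fun i j : Fin 3 => if i.val + j.val + 1 = 3 then (1 : L) else 0)).L2 μ,
            (∀ u ∈ U, (UnitaryGroup.cmDatum L 3 (Matrix.of fun i j : Fin 3 => if i.val + j.val + 1 = 3 then (1 : L) else 0)).rightRegular μ (ιK (MonoidHom.inr Kinf Kf u)) x = x) →
            (∀ t : Kinf, (UnitaryGroup.cmDatum L 3 (Matrix.of fun i j : Fin 3 => if i.val + j.val + 1 = 3 then (1 : L) else 0)).rightRegular μ (ιK (MonoidHom.inl Kinf Kf t)) x = χ t • x) →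
            P x = x) ∧
          ∀ W : ClosedSubrep ((UnitaryGroup.cmDatum L 3 (Matrix.of fun i j : Fin 3 => if i.val + j.val + 1 = 3 then (1 : L) else 0)).rightRegular μ),
            W.toContRep.IsTopIrreducible → W ≤ cmResidualSubspaceR L 3 μ → ∀ w ∈ W, P w ∈ At) :
    ∀ (L : Type) [Field L] [NumberField L] [IsCMField L]
      (μ : Measure (UnitaryGroup.cmDatum L 3 (Matrix.of fun i j : Fin 3 => if i.val + j.val + 1 = 3 then (1 : L) else 0)).automorphicQuotient)
      [(UnitaryGroup.cmDatum L 3 (Matrix.of fun i j : Fin 3 => if i.val + j.val + 1 = 3 then (1 : L) else 0)).IsAutomorphicMeasure μ],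
      K2E1CuspidalSpectrumUnitary.CmResidualSpectrumCompactR L 3 μ := by
  intro L _ _ _ μ _
  obtain ⟨Kinf, _, _, _, _, _, Kf, _, _, _, _, _, _, ιK, hι, hatoms⟩ := h L μ
  exact residualSpectrumCompact_of_atoms_prod _ μ (cmParabolicDataR L 3) ιK hι hatoms

end Sockets

end Summit.HodgeConjecture.HodgeConjecture.Cruxes.H413.K2E1ResidualAtomsProductGroupU

end
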